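import Literature.Geometry.DiscreteGeometry.ThreePointBoundGeneral
import Summits.Ventures.PackingBounds.Energy.TenPointCkFiveFacc2
import Summits.Ventures.PackingBounds.Energy.TenPointCkFiveFgrp3
import Summits.Ventures.PackingBounds.Energy.TenPointCkFiveFblk0
import Summits.Ventures.PackingBounds.Energy.TenPointCkFiveFblk1
import Summits.Ventures.PackingBounds.Energy.TenPointCkFiveFblk2
import Summits.Ventures.PackingBounds.Energy.TenPointCkFiveFblk3
import Summits.Ventures.PackingBounds.Energy.TenPointCkFiveFblk4
import Summits.Ventures.PackingBounds.Energy.TenPointCkFiveFblk5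
import Summits.Ventures.PackingBounds.Energy.TenPointCkFiveFblk6
import HarnessLib

/-!
# `TenPointCkFive`: the tree's factored three-point function `threePointF 4 7 6 dcoKW5 gwKW5` equals the expansion `FexpKW5`

Framing: lottery ticket; floor = certified bounds/negative ranges. Venture `PackingBounds`, cell
`pub-packcert`, energy family E3PT (pub-packcert-energy gen 14; n = 4 kernel route = KERNEL-D6 data route + `threePointF 4`).
-/

noncomputable section

open Finset

namespace Summit.Ventures.PackingBounds.Energy.TenPointCkFive

open Literature.Geometry.DiscreteGeometry Literature.Geometry.DiscreteGeometry.BachocVallentin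

/-- `Σ_{k<7} f k` written out. -/
private theorem sum_range_blocksW5 (f : ℕ → ℝ) : ∑ k ∈ range 7, f k = f 0 + f 1 + f 2 + f 3 + f 4 + f 5 + f 6 := by
  simp [Finset.sum_range_succ]

set_option maxRecDepth 20000 in
set_option maxHeartbeats 400000000 in
/-- The last staged partial sum lands on `FexpKW5` (`ring`). -/
theorem fgrp_top_eqW5 (u v t : ℝ) : Facc2KW5 u v t + Fgrp3KW5 u v t = FexpKW5 u v t := by
  unfold Facc2KW5 Fgrp3KW5 FexpKW5
  ring

/-- The tree's factored three-point function (`ThreePointBoundGeneral.threePointF`, `n = 4`) equals `FexpKW5` (blockwise identities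
`fblk<k>_eq`, staged sums, `linear_combination`). -/
theorem threePointF_eqW5 (u v t : ℝ) : threePointF 4 7 6 dcoKW5 gwKW5 u v t = FexpKW5 u v t := by
  rw [threePointF, sum_range_blocksW5, fblk0_eqW5, fblk1_eqW5, fblk2_eqW5, fblk3_eqW5, fblk4_eqW5, fblk5_eqW5, fblk6_eqW5]
  linear_combination fgrp0_eqW5 u v t + fgrp1_eqW5 u v t + fgrp2_eqW5 u v t + fgrp3_eqW5 u v t + facc1_eqW5 u v t + facc2_eqW5 u v t + fgrp_top_eqW5 u v t

end Summit.Ventures.PackingBounds.Energy.TenPointCkFive
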